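import Summits.QuantumAdvantage.QuantumAdvantage.Theorems.CharDialJLinSliceB

/-! # CharDialJLinSlice — part 3/3 (mechanical split for landing of `CharDialJLinSlice`; content verbatim; scopes re-opened with their variables) -/

set_option linter.dupNamespace false
noncomputable section

namespace Summit.QuantumAdvantage.AdviceFreeQNC0.JLinPeel
open Finset Summit.QuantumAdvantage.AdviceFreeQNC0 JLinData
variable {p : ℕ} {n : ℕ}

/-- **Rank-one hardness on JUNTA-FREE data is R11′ at `K = 1`** (tree `walkHardFLinForms`, `p ≠ 3`): PROVED. -/
theorem rankOne_noJunta [Fact p.Prime] (hp3 : p ≠ 3) :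
    ∃ θ : ℝ, θ < 1 ∧ ∃ n₀ : ℕ, ∀ n ≥ n₀, ∀ (c : ℕ) (D : JLinData p n),
      (∀ g, D.J g = ∅) → (∃ a : Fin n → ZMod p, ∀ g, g ∉ D.blindCuts → ∃ l : ZMod p, D.a g = fun i => l * a i) →
        (winCount c D.strat : ℝ) ≤ θ * (2 : ℝ) ^ n := by
  classical
  obtain ⟨θ, hθ, H⟩ := walkHardFLinForms p hp3
  obtain ⟨n₀, hn₀⟩ := H 0
  refine ⟨θ, hθ, n₀, fun n hn c D hJ ⟨a, ha⟩ => ?_⟩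
  let u₀ : Fin n → Bool := fun _ => false
  let lam : Fin 1 → Fin n → ZMod p := fun _ => a
  let tab : Fin (n + 1) → (Fin 1 → ZMod p) → Bool := fun g v =>
    if hb : g ∈ D.blindCuts then D.h g u₀ 0 else D.h g u₀ (Classical.choose (ha g hb) * v 0)
  have hfree : ∀ g u s, D.h g u s = D.h g u₀ s := fun g u s => D.hJ g u u₀ (fun i hi => by rw [hJ g] at hi; simp at hi) s
  have hstrat : D.strat = fun g v => tab g (fun j => ∑ i, (if v i then lam j i else 0)) := by
    funext g u
    simp only [tab, lam, JLinData.strat]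
    split_ifs with hb
    · rw [hfree]; exact (D.mem_blindCuts.1 hb) u₀ _ _
    · have hag := Classical.choose_spec (ha g hb)
      have hag' : ∀ i, D.a g i = Classical.choose (ha g hb) * a i := fun i => congr_fun hag i
      have hform : D.form g u = Classical.choose (ha g hb) * ∑ i, (if u i then a i else 0) := by
        unfold JLinData.form
        rw [mul_sum]
        refine sum_congr rfl fun i _ => ?_
        rw [hag' i]
        split_ifs <;> simp
      rw [hform, hfree]
  have := hn₀ n hn c 1 (by rw [pow_zero]) lam tab
  unfold winCount
  rw [hstrat]
  exact this

/-! ## §5 The «own bit ⊕ counter table» family: rank-one, beyond every landed rung -/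

/-- the «own bit ⊕ counter table» data of a table family `T`. -/
def ownBitCounter (p n : ℕ) (T : Fin (n + 1) → Bool → ZMod p → Bool) : JLinData p n where
  J := fun g => univ.filter fun i : Fin n => i.val = g.val
  a := fun _ _ => 1
  h := fun g u s => T g (decide (∀ i : Fin n, i.val = g.val → u i = true)) s
  hJ := fun g u v huv s => by
    have : (∀ i : Fin n, i.val = g.val → u i = true) ↔ (∀ i : Fin n, i.val = g.val → v i = true) :=
      forall_congr' fun i => imp_congr_right fun hi => by
        rw [huv i (mem_filter.2 ⟨mem_univ _, hi⟩)]
    simp only [this]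

/-- CharDialJLinSlice helper `ownBitCounter_juntaBound_log` (decomp-qadv land package; see the module docstring). -/
theorem ownBitCounter_juntaBound_log (hn : 2 ≤ n) (T : Fin (n + 1) → Bool → ZMod p → Bool) (g : Fin (n + 1)) :
    ((ownBitCounter p n T).J g).card ≤ Nat.log 2 n := by
  refine le_trans (card_le_one.2 fun i hi j hj => ?_) (Nat.le_log_of_pow_le (by norm_num) (by simpa using hn))
  simp only [ownBitCounter, mem_filter, mem_univ, true_and] at hi hj
  exact Fin.ext (hi.trans hj.symm)

/-- CharDialJLinSlice helper `ownBitCounter_rankOne` (decomp-qadv land package; see the module docstring). -/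
theorem ownBitCounter_rankOne (T : Fin (n + 1) → Bool → ZMod p → Bool) :
    ∃ a : Fin n → ZMod p, ∀ g, g ∉ (ownBitCounter p n T).blindCuts → ∃ l : ZMod p, (ownBitCounter p n T).a g = fun i => l * a i :=
  ⟨fun _ => 1, fun g _ => ⟨1, funext fun i => by simp [ownBitCounter]⟩⟩

/-- **Rank-one hardness ⟹ hardness of every «own bit ⊕ counter table» strategy** `y_g(u) = T_g(u_g, wt u mod p)` (PROVED:
the family is rank-one with juntas of size `≤ 1 ≤ log₂ n`).  The family lies outside the hypotheses of `FinState2` (own bit ≠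
prefix count), window-local rungs (global counter), `WalkHardFLinForms`/`WalkHardFLinFormsSqrt`/`LinTestsOdd` (`n + 1` distinct
forms) and has `𝔽_p`-degree `p` (beyond `SubCharHardOdd`). -/
theorem ownBitCounter_of_rankOne (h : (∃ θ : ℝ, θ < 1 ∧ ∃ n₀ : ℕ, ∀ n ≥ n₀, ∀ (c : ℕ) (D : JLinData p n),
      (∀ g, (D.J g).card ≤ Nat.log 2 n) → (∃ a : Fin n → ZMod p, ∀ g, g ∉ D.blindCuts → ∃ l : ZMod p, D.a g = fun i => l * a i) → (winCount c D.strat : ℝ) ≤ θ * (2 : ℝ) ^ n)) :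
    ∃ θ : ℝ, θ < 1 ∧ ∃ n₀ : ℕ, ∀ n ≥ n₀, ∀ (c : ℕ) (T : Fin (n + 1) → Bool → ZMod p → Bool),
      (winCount c (ownBitCounter p n T).strat : ℝ) ≤ θ * (2 : ℝ) ^ n := by
  obtain ⟨θ, hθ, n₀, hn₀⟩ := h
  refine ⟨θ, hθ, max n₀ 2, fun n hn c T => hn₀ n (le_trans (le_max_left _ _) hn) c _
    (ownBitCounter_juntaBound_log (le_trans (le_max_right _ _) hn) T) (ownBitCounter_rankOne T)⟩

/-- No cut of an own-bit ⊕ counter strategy with `T_g(b,s) = b ∧ [s = 0]` is blind, every bit is junta-declared (so the data is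
dense-read at every threshold and a group-core at every lightness `L ≥ 1`): the family meets the read-density split's «barrier
locus» while being rank-one. -/
theorem ownBitCounter_sparseBits [Fact p.Prime] (T : Fin (n + 1) → Bool → ZMod p → Bool) (R : ℕ) :
    (ownBitCounter p n T).sparseBits R = ∅ :=
  eq_empty_of_forall_notMem fun i hi => ((mem_sparseBits _).1 hi).1 ⟨i.val, by omega⟩ (by simp [ownBitCounter])

/-- CharDialJLinSlice helper `ownBitCounter_lightGroups` (decomp-qadv land package; see the module docstring). -/
theorem ownBitCounter_lightGroups [Fact p.Prime] (T : Fin (n + 1) → Bool → ZMod p → Bool) {L : ℕ} (hL : 1 ≤ L) :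
    (ownBitCounter p n T).lightGroups L = ∅ := by
  classical
  refine lightGroups_eq_empty_of_forall _ fun G hG => ?_
  rw [mem_lightGroups] at hG
  obtain ⟨⟨g₀, hg₀⟩, -, hwt⟩ := hG
  let t : Fin (n + 1) → ZMod p := fun g => if g = g₀ then 1 else 0
  have ht : t ∈ tSet p G := mem_tSet.2 fun g hg => by
    simp only [t]
    split_ifs with h
    · exact absurd (h ▸ hg₀) hg
    · rfl
  have ht0 : t ≠ 0 := fun h0 => by
    have := congr_fun h0 g₀
    simp [t] at this
  have h1 := hwt t ht ht0
  have h2 : (ownBitCounter p n T).privWt G t = 0 := by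
    refine card_eq_zero.2 (eq_empty_of_forall_notMem fun i hi => ?_)
    have hi' := (mem_filter.1 (mem_filter.1 hi).1).2.1
    exact hi' ⟨i.val, by omega⟩ (by simp [ownBitCounter])
  have h3 : 1 ≤ G.card := card_pos.2 ⟨g₀, hg₀⟩
  have h4 : 1 * 1 ≤ L * G.card := Nat.mul_le_mul hL h3
  omega

/-- CharDialJLinSlice helper `ownBitCounter_not_blind` (decomp-qadv land package; see the module docstring). -/
theorem ownBitCounter_not_blind [Fact p.Prime] (g : Fin (n + 1)) :
    g ∉ (ownBitCounter p n (fun _ b s => b && decide (s = 0))).blindCuts := by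
  intro hb
  have h := (JLinData.mem_blindCuts _).1 hb (fun _ => true) 0 1
  have h1 : (1 : ZMod p) ≠ 0 := one_ne_zero
  simp [ownBitCounter, h1] at h

/-! ## §6 The SPARSE-DIRECTION regime is PROVED (tree `walkHardAllSubcube`)

A slice `{⟨a,u⟩ = s}` with `|supp a| ≤ δ₀·n` is a disjoint union of coordinate subcubes over `W = supp a`; a junta strategy
restricted to a subcube is a junta of the free bits, so `AffBells22.walkHardAllSubcube` (every `δ₀ < 1`, ONE `θ`) bounds every
subcube and hence the slice at ratio `θ`; with the slicing engine, rank-one data with a sparse common direction lose.  What stays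
open on the rank-one side is the DENSE common direction only (`rankOne_of_dense`). -/

section SparseDir

open AffBells22

/-- swapping the `W`-parts of a pair of inputs twice is the identity. -/
theorem subcubeMerge_merge (W : Finset (Fin n)) (b u : Fin n → Bool) :
    subcubeMerge W (subcubeMerge W b u) (subcubeMerge W u b) = b := by
  funext i
  by_cases hi : i ∈ W <;> simp [subcubeMerge, hi]

/-- **fibre counting**: summing the subcube counts of a property over all patterns `b` counts it `2ⁿ` times. -/
theorem sum_card_subcube (W : Finset (Fin n)) (P : (Fin n → Bool) → Prop) [DecidablePred P] :
    (∑ b : Fin n → Bool, (univ.filter fun u : Fin n → Bool => P (subcubeMerge W b u)).card) =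
      2 ^ n * (univ.filter P).card := by
  classical
  let Φ : (Fin n → Bool) × (Fin n → Bool) → (Fin n → Bool) × (Fin n → Bool) :=
    fun x => (subcubeMerge W x.1 x.2, subcubeMerge W x.2 x.1)
  have hΦ : Function.Involutive Φ := fun x => by
    simp only [Φ, subcubeMerge_merge]
  let e : (Fin n → Bool) × (Fin n → Bool) ≃ (Fin n → Bool) × (Fin n → Bool) := hΦ.toPerm Φ
  have h1 : (∑ b : Fin n → Bool, (univ.filter fun u : Fin n → Bool => P (subcubeMerge W b u)).card) =
      ∑ x : (Fin n → Bool) × (Fin n → Bool), (if P (Φ x).1 then 1 else 0) := by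
    rw [Fintype.sum_prod_type]
    refine sum_congr rfl fun b _ => ?_
    rw [card_filter]
  have h2 : (∑ x : (Fin n → Bool) × (Fin n → Bool), (if P (Φ x).1 then 1 else 0)) =
      ∑ x : (Fin n → Bool) × (Fin n → Bool), (if P x.1 then 1 else 0) :=
    Equiv.sum_comp e (fun x => if P x.1 then 1 else 0)
  have h3 : (∑ x : (Fin n → Bool) × (Fin n → Bool), (if P x.1 then 1 else 0)) = 2 ^ n * (univ.filter P).card := by
    rw [Fintype.sum_prod_type, card_filter, mul_sum]
    refine sum_congr rfl fun v _ => ?_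
    split_ifs <;> simp
  rw [h1, h2, h3]

/-- on a subcube over `W ⊇ supp a` the form value is constant. -/
theorem linVal_merge {a : Fin n → ZMod p} {W : Finset (Fin n)} (hW : ∀ i, i ∉ W → a i = 0) (b u : Fin n → Bool) :
    linVal a (subcubeMerge W b u) = linVal a (subcubeMerge W b fun _ => false) := by
  unfold linVal
  refine sum_congr rfl fun i _ => ?_
  by_cases hi : i ∈ W
  · simp [subcubeMerge, hi]
  · simp [subcubeMerge, hi, hW i hi]

/-- **Per-slice junta hardness for every direction of support `≤ δ₀·n`: PROVED** (ONE `θ < 1` for all such directions and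
slices, from the tree's subcube walk hardness `walkHardAllSubcube`). -/
theorem slice_sparseDir [Fact p.Prime] {δ₀ : ℝ} (hδ₀ : δ₀ < 1) :
    ∃ θ : ℝ, θ < 1 ∧ ∃ n₀ : ℕ, ∀ n ≥ n₀, ∀ (c : ℕ) (a : Fin n → ZMod p) (s : ZMod p)
      (y : Fin (n + 1) → (Fin n → Bool) → Bool),
      (((univ.filter fun i : Fin n => a i ≠ 0).card : ℝ) ≤ δ₀ * n) →
      (∀ g, ∃ J : Finset (Fin n), J.card ≤ Nat.log 2 n ∧ ∀ u v : Fin n → Bool, (∀ i ∈ J, u i = v i) → y g u = y g v) →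
        ((univ.filter fun u : Fin n → Bool => linVal a u = s ∧ ringWinU c y u = true).card : ℝ) ≤
          θ * ((univ.filter fun u : Fin n → Bool => linVal a u = s).card : ℝ) := by
  classical
  obtain ⟨θ, hθ, H⟩ := walkHardAllSubcube hδ₀
  obtain ⟨n₀, hn₀⟩ := H 1
  refine ⟨θ, hθ, n₀, fun n hn c a s y hsupp hy => ?_⟩
  set W : Finset (Fin n) := univ.filter fun i : Fin n => a i ≠ 0 with hWdef
  have hW : ∀ i, i ∉ W → a i = 0 := fun i hi => by
    by_contra h
    exact hi (by rw [hWdef, mem_filter]; exact ⟨mem_univ _, h⟩)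
  let sW : (Fin n → Bool) → ZMod p := fun b => linVal a (subcubeMerge W b fun _ => false)
  have hlin : ∀ b u, linVal a (subcubeMerge W b u) = sW b := fun b u => linVal_merge hW b u
  have hsub : ∀ b : Fin n → Bool,
      ((univ.filter fun u : Fin n → Bool => ringWinU c y (subcubeMerge W b u) = true).card : ℝ) ≤ θ * (2 : ℝ) ^ n := by
    intro b
    refine hn₀ n hn c W b hsupp y fun g => ?_
    obtain ⟨J, hJ, hyg⟩ := hy g
    rw [pow_one]
    exact BlockFibre37.hasDeg_of_dependsOn J hJ fun u v huv => hyg _ _ fun i hi => by simp [subcubeMerge, huv i hi]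
  have hA := sum_card_subcube W (fun v : Fin n → Bool => linVal a v = s ∧ ringWinU c y v = true)
  have hB := sum_card_subcube W (fun v : Fin n → Bool => linVal a v = s)
  have hA' : ∀ b : Fin n → Bool,
      (univ.filter fun u : Fin n → Bool => linVal a (subcubeMerge W b u) = s ∧ ringWinU c y (subcubeMerge W b u) = true).card
        = if sW b = s then (univ.filter fun u : Fin n → Bool => ringWinU c y (subcubeMerge W b u) = true).card else 0 := by
    intro b
    split_ifs with hs
    · exact congrArg card (filter_congr fun u _ => by rw [hlin b u]; simp [hs])
    · rw [card_eq_zero, filter_eq_empty_iff]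
      intro u _ ⟨h1, _⟩
      exact hs (by rw [← hlin b u]; exact h1)
  have hB' : ∀ b : Fin n → Bool,
      (univ.filter fun u : Fin n → Bool => linVal a (subcubeMerge W b u) = s).card = if sW b = s then 2 ^ n else 0 := by
    intro b
    split_ifs with hs
    · rw [filter_true_of_mem fun u _ => by rw [hlin b u]; exact hs]
      simp
    · rw [card_eq_zero, filter_eq_empty_iff]
      intro u _ h1
      exact hs (by rw [← hlin b u]; exact h1)
  have h2n : (0 : ℝ) < (2 : ℝ) ^ n := by positivity
  have hAr : (2 : ℝ) ^ n * ((univ.filter fun v : Fin n → Bool => linVal a v = s ∧ ringWinU c y v = true).card : ℝ)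
      ≤ θ * (2 : ℝ) ^ n * ((univ.filter fun b : Fin n → Bool => sW b = s).card : ℝ) := by
    have e1 : (2 : ℝ) ^ n * ((univ.filter fun v : Fin n → Bool => linVal a v = s ∧ ringWinU c y v = true).card : ℝ)
        = ∑ b : Fin n → Bool, ((if sW b = s then
            (univ.filter fun u : Fin n → Bool => ringWinU c y (subcubeMerge W b u) = true).card else 0 : ℕ) : ℝ) := by
      rw [← Nat.cast_sum, ← Finset.sum_congr rfl fun b _ => hA' b, hA]
      push_cast
      ring
    rw [e1]
    calc (∑ b : Fin n → Bool, ((if sW b = s then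
            (univ.filter fun u : Fin n → Bool => ringWinU c y (subcubeMerge W b u) = true).card else 0 : ℕ) : ℝ))
        ≤ ∑ b : Fin n → Bool, (if sW b = s then θ * (2 : ℝ) ^ n else 0) := by
          refine sum_le_sum fun b _ => ?_
          split_ifs with hs
          · exact_mod_cast hsub b
          · simp
      _ = θ * (2 : ℝ) ^ n * ((univ.filter fun b : Fin n → Bool => sW b = s).card : ℝ) := by
          rw [← sum_filter, sum_const, card_eq_sum_ones, Nat.cast_sum]
          push_cast
          simp [mul_comm]
  have hBr : (2 : ℝ) ^ n * ((univ.filter fun v : Fin n → Bool => linVal a v = s).card : ℝ)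
      = (2 : ℝ) ^ n * ((univ.filter fun b : Fin n → Bool => sW b = s).card : ℝ) := by
    have e1 : (2 ^ n * (univ.filter fun v : Fin n → Bool => linVal a v = s).card : ℕ)
        = ∑ b : Fin n → Bool, (if sW b = s then 2 ^ n else 0 : ℕ) := by
      rw [← hB]
      exact Finset.sum_congr rfl fun b _ => hB' b
    have e2 : (∑ b : Fin n → Bool, (if sW b = s then 2 ^ n else 0 : ℕ)) = 2 ^ n * (univ.filter fun b : Fin n → Bool => sW b = s).card := by
      rw [← sum_filter, sum_const, smul_eq_mul, mul_comm]
    have e3 := e1.trans e2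
    exact_mod_cast e3
  have key : (2 : ℝ) ^ n * ((univ.filter fun v : Fin n → Bool => linVal a v = s ∧ ringWinU c y v = true).card : ℝ)
      ≤ (2 : ℝ) ^ n * (θ * ((univ.filter fun u : Fin n → Bool => linVal a u = s).card : ℝ)) := by
    calc _ ≤ θ * (2 : ℝ) ^ n * ((univ.filter fun b : Fin n → Bool => sW b = s).card : ℝ) := hAr
      _ = θ * ((2 : ℝ) ^ n * ((univ.filter fun b : Fin n → Bool => sW b = s).card : ℝ)) := by ring
      _ = θ * ((2 : ℝ) ^ n * ((univ.filter fun v : Fin n → Bool => linVal a v = s).card : ℝ)) := by rw [hBr]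
      _ = _ := by ring
  exact le_of_mul_le_mul_left key h2n

/-- **slicing engine, pointwise in the direction**: per-slice junta bounds for direction `a` (at this `n`, `c`, ratio `θ`)
bound every rank-one datum with common direction `a`. -/
theorem winCount_le_of_sliceBound [Fact p.Prime] {θ : ℝ} {c : ℕ} (a : Fin n → ZMod p)
    (hslice : ∀ (s : ZMod p) (y : Fin (n + 1) → (Fin n → Bool) → Bool),
      (∀ g, ∃ J : Finset (Fin n), J.card ≤ Nat.log 2 n ∧ ∀ u v : Fin n → Bool, (∀ i ∈ J, u i = v i) → y g u = y g v) →
        ((univ.filter fun u : Fin n → Bool => linVal a u = s ∧ ringWinU c y u = true).card : ℝ) ≤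
          θ * ((univ.filter fun u : Fin n → Bool => linVal a u = s).card : ℝ))
    (D : JLinData p n) (hJ : ∀ g, (D.J g).card ≤ Nat.log 2 n) (ha : ∀ g, g ∉ D.blindCuts → ∃ l : ZMod p, D.a g = fun i => l * a i) :
    (winCount c D.strat : ℝ) ≤ θ * (2 : ℝ) ^ n := by
  classical
  let ys : ZMod p → Fin (n + 1) → (Fin n → Bool) → Bool := fun s g u =>
    if hb : g ∈ D.blindCuts then D.h g u 0 else D.h g u (Classical.choose (ha g hb) * s)
  have hys : ∀ s g, ∃ J : Finset (Fin n), J.card ≤ Nat.log 2 n ∧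
      ∀ u v : Fin n → Bool, (∀ i ∈ J, u i = v i) → ys s g u = ys s g v := fun s g =>
    ⟨D.J g, hJ g, fun u v huv => by
      simp only [ys]
      split_ifs with hb
      · exact D.hJ g u v huv 0
      · exact D.hJ g u v huv _⟩
  have hstrat : ∀ s u, linVal a u = s → ∀ g, D.strat g u = ys s g u := by
    intro s u hu g
    simp only [ys, JLinData.strat]
    split_ifs with hb
    · exact (D.mem_blindCuts.1 hb) u _ _
    · have hag := Classical.choose_spec (ha g hb)
      have hag' : ∀ i, D.a g i = Classical.choose (ha g hb) * a i := fun i => congr_fun hag i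
      have hform : D.form g u = Classical.choose (ha g hb) * s := by
        unfold JLinData.form
        rw [← hu]
        unfold linVal
        rw [mul_sum]
        refine sum_congr rfl fun i _ => ?_
        rw [hag' i]
        split_ifs <;> simp
      rw [hform]
  have hcount : (winCount c D.strat : ℝ) =
      ∑ s : ZMod p, ((univ.filter fun u : Fin n → Bool => linVal a u = s ∧ ringWinU c (ys s) u = true).card : ℝ) := by
    unfold winCount
    rw [← Nat.cast_sum, card_eq_sum_card_fiberwise (f := fun u : Fin n → Bool => linVal a u) (t := univ)
      (fun _ _ => mem_univ _)]
    congr 1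
    refine sum_congr rfl fun s _ => congrArg card ?_
    ext u
    simp only [mem_filter, mem_univ, true_and]
    constructor
    · rintro ⟨hw, hu⟩
      exact ⟨hu, by rwa [← UnreadTwist.ringWinU_congr (hstrat s u hu)]⟩
    · rintro ⟨hu, hw⟩
      exact ⟨by rwa [UnreadTwist.ringWinU_congr (hstrat s u hu)], hu⟩
  rw [hcount]
  calc (∑ s : ZMod p, ((univ.filter fun u : Fin n → Bool => linVal a u = s ∧ ringWinU c (ys s) u = true).card : ℝ))
      ≤ ∑ s : ZMod p, θ * ((univ.filter fun u : Fin n → Bool => linVal a u = s).card : ℝ) :=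
        sum_le_sum fun s _ => hslice s (ys s) (hys s)
    _ = θ * (2 : ℝ) ^ n := by rw [← mul_sum, sum_card_slices]

/-- **Rank-one data with a SPARSE common direction (support `≤ δ₀·n`) lose — PROVED for every `δ₀ < 1`** (contains «per-cut
`log₂ n`-juntas ⊕ one common sparse `MOD p` counter», beyond the junta rung `a = 0` and beyond the junta-free rungs). -/
theorem rankOne_sparseDir [Fact p.Prime] {δ₀ : ℝ} (hδ₀ : δ₀ < 1) :
    ∃ θ : ℝ, θ < 1 ∧ ∃ n₀ : ℕ, ∀ n ≥ n₀, ∀ (c : ℕ) (D : JLinData p n),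
      (∀ g, (D.J g).card ≤ Nat.log 2 n) →
      (∃ a : Fin n → ZMod p, (((univ.filter fun i : Fin n => a i ≠ 0).card : ℝ) ≤ δ₀ * n) ∧
        ∀ g, g ∉ D.blindCuts → ∃ l : ZMod p, D.a g = fun i => l * a i) →
        (winCount c D.strat : ℝ) ≤ θ * (2 : ℝ) ^ n := by
  obtain ⟨θ, hθ, n₀, hn₀⟩ := slice_sparseDir (p := p) hδ₀
  exact ⟨θ, hθ, n₀, fun n hn c D hJ ⟨a, hsupp, ha⟩ =>
    winCount_le_of_sliceBound a (fun s y hy => hn₀ n hn c a s y hsupp hy) D hJ ha⟩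

/-- **Rank-one hardness follows from its DENSE-direction case** (support `> δ₀·n`), any `δ₀ < 1` — PROVED. -/
theorem rankOne_of_dense [Fact p.Prime] {δ₀ : ℝ} (hδ₀ : δ₀ < 1) (h : (∃ θ : ℝ, θ < 1 ∧ ∃ n₀ : ℕ, ∀ n ≥ n₀, ∀ (c : ℕ) (D : JLinData p n),
      (∀ g, (D.J g).card ≤ Nat.log 2 n) → (∃ a : Fin n → ZMod p, δ₀ * n < (((univ.filter fun i : Fin n => a i ≠ 0).card : ℝ)) ∧
        ∀ g, g ∉ D.blindCuts → ∃ l : ZMod p, D.a g = fun i => l * a i) → (winCount c D.strat : ℝ) ≤ θ * (2 : ℝ) ^ n)) : (∃ θ : ℝ, θ < 1 ∧ ∃ n₀ : ℕ, ∀ n ≥ n₀, ∀ (c : ℕ) (D : JLinData p n),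
      (∀ g, (D.J g).card ≤ Nat.log 2 n) → (∃ a : Fin n → ZMod p, ∀ g, g ∉ D.blindCuts → ∃ l : ZMod p, D.a g = fun i => l * a i) → (winCount c D.strat : ℝ) ≤ θ * (2 : ℝ) ^ n) := by
  obtain ⟨θ₁, hθ₁, n₁, h₁⟩ := h
  obtain ⟨θ₂, hθ₂, n₂, h₂⟩ := rankOne_sparseDir (p := p) hδ₀
  refine ⟨max θ₁ θ₂, max_lt hθ₁ hθ₂, max n₁ n₂, fun n hn c D hJ ⟨a, ha⟩ => ?_⟩
  have h2n : (0 : ℝ) ≤ (2 : ℝ) ^ n := by positivity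
  by_cases hs : (((univ.filter fun i : Fin n => a i ≠ 0).card : ℝ)) ≤ δ₀ * n
  · exact (h₂ n (le_trans (le_max_right _ _) hn) c D hJ ⟨a, hs, ha⟩).trans
      (mul_le_mul_of_nonneg_right (le_max_right _ _) h2n)
  · exact (h₁ n (le_trans (le_max_left _ _) hn) c D hJ ⟨a, lt_of_not_ge hs, ha⟩).trans
      (mul_le_mul_of_nonneg_right (le_max_left _ _) h2n)

/-- **The sharpened split: 32604's data form at `p` ⟺ (DENSE rank-one hardness) ∧ (semantic rank-≥2 hardness)**, any `δ₀ < 1`. -/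
theorem data_iff_denseSemSplit [Fact p.Prime] {δ₀ : ℝ} (hδ₀ : δ₀ < 1) :
    (∃ θ : ℝ, θ < 1 ∧ ∃ n₀ : ℕ, ∀ n ≥ n₀, ∀ (c : ℕ) (D : JLinData p n),
      (∀ g, (D.J g).card ≤ Nat.log 2 n) → (winCount c D.strat : ℝ) ≤ θ * (2 : ℝ) ^ n) ↔ ((∃ θ : ℝ, θ < 1 ∧ ∃ n₀ : ℕ, ∀ n ≥ n₀, ∀ (c : ℕ) (D : JLinData p n),
      (∀ g, (D.J g).card ≤ Nat.log 2 n) → (∃ a : Fin n → ZMod p, δ₀ * n < (((univ.filter fun i : Fin n => a i ≠ 0).card : ℝ)) ∧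
        ∀ g, g ∉ D.blindCuts → ∃ l : ZMod p, D.a g = fun i => l * a i) → (winCount c D.strat : ℝ) ≤ θ * (2 : ℝ) ^ n) ∧ (∃ θ : ℝ, θ < 1 ∧ ∃ n₀ : ℕ, ∀ n ≥ n₀, ∀ (c : ℕ) (D : JLinData p n),
      (∀ g, (D.J g).card ≤ Nat.log 2 n) → ¬ (∃ D' : JLinData p n, D'.strat = D.strat ∧ (∀ g, (D'.J g).card ≤ Nat.log 2 n) ∧
        ∃ a : Fin n → ZMod p, ∀ g, g ∉ D'.blindCuts → ∃ l : ZMod p, D'.a g = fun i => l * a i) → (winCount c D.strat : ℝ) ≤ θ * (2 : ℝ) ^ n)) := by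
  rw [data_iff_semSplit (p := p)]
  constructor
  · rintro ⟨⟨θ, hθ, n₀, hn₀⟩, h2⟩
    exact ⟨⟨θ, hθ, n₀, fun n hn c D hJ ⟨a, _, ha⟩ => hn₀ n hn c D hJ ⟨a, ha⟩⟩, h2⟩
  · rintro ⟨h1, h2⟩
    exact ⟨rankOne_of_dense hδ₀ h1, h2⟩

/-- **CharDial's `WalkHardFJLinOdd` ⟺ (dense rank-one hardness ∧ semantic rank-≥2 hardness at every prime `p ≥ 5`)**, any `δ₀ < 1`. -/
theorem charDial_walkHardFJLinOdd_iff_denseSemSplit {δ₀ : ℝ} (hδ₀ : δ₀ < 1) :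
    Summit.QuantumAdvantage.QuantumAdvantage.Theses.CharDial.WalkHardFJLinOdd ↔
      (∀ (p : ℕ) [Fact p.Prime], 5 ≤ p → ((∃ θ : ℝ, θ < 1 ∧ ∃ n₀ : ℕ, ∀ n ≥ n₀, ∀ (c : ℕ) (D : JLinData p n),
      (∀ g, (D.J g).card ≤ Nat.log 2 n) → (∃ a : Fin n → ZMod p, δ₀ * n < (((univ.filter fun i : Fin n => a i ≠ 0).card : ℝ)) ∧
        ∀ g, g ∉ D.blindCuts → ∃ l : ZMod p, D.a g = fun i => l * a i) → (winCount c D.strat : ℝ) ≤ θ * (2 : ℝ) ^ n) ∧ (∃ θ : ℝ, θ < 1 ∧ ∃ n₀ : ℕ, ∀ n ≥ n₀, ∀ (c : ℕ) (D : JLinData p n),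
      (∀ g, (D.J g).card ≤ Nat.log 2 n) → ¬ (∃ D' : JLinData p n, D'.strat = D.strat ∧ (∀ g, (D'.J g).card ≤ Nat.log 2 n) ∧
        ∃ a : Fin n → ZMod p, ∀ g, g ∉ D'.blindCuts → ∃ l : ZMod p, D'.a g = fun i => l * a i) → (winCount c D.strat : ℝ) ≤ θ * (2 : ℝ) ^ n))) := by
  constructor
  · intro h p _ hp
    exact (data_iff_denseSemSplit hδ₀).1 (data_of_pres p (h p hp))
  · intro h p _ hp
    exact pres_of_data p ((data_iff_denseSemSplit hδ₀).2 (h p hp))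

/-- **CharDial's rung leaf from the sharpened split and the route's other items BY NAME.** -/
theorem charDial_closes_of_denseSemSplit {δ₀ : ℝ} (hδ₀ : δ₀ < 1)
    (hL : Summit.QuantumAdvantage.QuantumAdvantage.Theses.CharDial.FrobStructureLaw)
    (h : ∀ (p : ℕ) [Fact p.Prime], 5 ≤ p → ((∃ θ : ℝ, θ < 1 ∧ ∃ n₀ : ℕ, ∀ n ≥ n₀, ∀ (c : ℕ) (D : JLinData p n),
      (∀ g, (D.J g).card ≤ Nat.log 2 n) → (∃ a : Fin n → ZMod p, δ₀ * n < (((univ.filter fun i : Fin n => a i ≠ 0).card : ℝ)) ∧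
        ∀ g, g ∉ D.blindCuts → ∃ l : ZMod p, D.a g = fun i => l * a i) → (winCount c D.strat : ℝ) ≤ θ * (2 : ℝ) ^ n) ∧ (∃ θ : ℝ, θ < 1 ∧ ∃ n₀ : ℕ, ∀ n ≥ n₀, ∀ (c : ℕ) (D : JLinData p n),
      (∀ g, (D.J g).card ≤ Nat.log 2 n) → ¬ (∃ D' : JLinData p n, D'.strat = D.strat ∧ (∀ g, (D'.J g).card ≤ Nat.log 2 n) ∧
        ∃ a : Fin n → ZMod p, ∀ g, g ∉ D'.blindCuts → ∃ l : ZMod p, D'.a g = fun i => l * a i) → (winCount c D.strat : ℝ) ≤ θ * (2 : ℝ) ^ n)))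
    (hLift : Summit.QuantumAdvantage.QuantumAdvantage.Theses.CharDial.FrobLiftOdd)
    (hD : Summit.QuantumAdvantage.QuantumAdvantage.Theses.CharDial.DegLiftOdd) :
    Summit.QuantumAdvantage.AdviceFreeQNC0.AdviceFreeQNC0Odd :=
  charDial_closes_of_core hL
    (fun p _ hp => core_of_pres p ((charDial_walkHardFJLinOdd_iff_denseSemSplit hδ₀).2 h p hp)) hLift hD

end SparseDir


end Summit.QuantumAdvantage.AdviceFreeQNC0.JLinPeel
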